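import Literature.AnabelianGeometry.EtaleTheta.Discharge.Sec2HasMuLModelChiCusp
import Mathlib.GroupTheory.Subgroup.Centralizer
import HarnessLib

/-!
# [EtTh] Cor. 2.9 at the Kummer-carrying cusped inversion model `χ′`: the cusp hypothesis `hC1` FAILS for the R312 cover of
# record — its SYNTHETIC section cusp datum `D̄_x := Δ̄_Θ·incl(ŝ(G_K))` is centralised by the `Z`-generator `a` (proof-only census)

S. Mochizuki, *The étale theta function and its Frobenioid-theoretic manifestations*, Publ. RIMS **45** (2009) [EtTh], §2:
Def. 2.1 p. 35 («`1 → Δ̄_Θ → D̄_x → G_K → 1`»), Cor. 2.9 p. 43 [cite: MochizukiEtTh2009, Cor 2.9 p.43]. Cell abc-iut, layer L2,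
seat abc-iut-L2-t12 (gen 9), L2-lead row «(w2c) COR29 COUNT AT χ′» (R924) — the CENSUS in the kernel (finding F-L2t12g9-1).
PROOF-ONLY (no definition, no instance, no `Prop` fact). Inputs BY NAME: abc-iut-L2-d3 / abc-iut-L2-t10's R312 constructor
`CLevelData.temperedCoverDataOfHuuOfSection` with `temperedCoverDataOfHuuOfSection_tp_PiXu`, abc-iut-L2-t10's section cusp datum
`PiCData.coverDataAxOfSection` (`Dx := Δ̄_Θ-preimage ⊔ sectionRange s`), the χ-twist `twistGfp` / `twist_eta_of_zero`
(`θ_u : a ↦ a, b ↦ b^u`), the `χ′` plumbing (`cLevelDataInvχ'`, `toPiCHat`, `sectionχ'`, `piCDataOf_incl_toHat`).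

WHAT. Let `T` be THE R312 cover of record on `Π^tp_C(inversionModelχ′)` (the term of abc-iut-L2-t10's `hasMuL_coverOfRecordχ'`:
completion `toPiCHat`, Galois section `sectionχ′ : σ ↦ inr σ`, `g := ε_±`), and `g_a := inclX(inl a)` the image of the degree-`1`
generator `a` of `Γ = F̂₂ ×_Ẑ ℤ` (`gfpOf (FreeGroup.of 0)`).
* (private `actχ_gfpOf_zero_eq_self`, cf. abc-iut p461839 `actχ_gfpOf_zero`) `G_{ℚ_p}` FIXES `a` (the χ-twist acts on `b` only); `inl a` commutes with every `inr σ`;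
* `inclX_inl_gfpOf_zero_mem_cuspStabC_coverOfRecordχ'` — **`g_a ∈ T.cuspStabC`** (= `N_{Π^tp_C}(Π^tp`-pull-back of `D_x`)):
  `ιC(g_a)` centralises the section image and `Δ̄_Θ`-preimage is normal;
* `…_mem_tp_PiX_…`, `…_not_mem_tp_PiXu_…` — `g_a ∈ Π^tp_X` but `g_a ∉ Π^tp_{X̲} = inclX(GtpXu l)` for `l ≠ 1` (`toZ a = 1`);
* **`not_hC1_coverOfRecordχ'`** — the cusp hypothesis `hC1 : T.cuspStabC ⊓ T.tp T.PiX ≤ T.tp T.PiXu` of abc-iut-L2-d3's Cor. 2.9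
  engine (`natCard_cuspOrbits_of_normalizer_eq`, `cor29_card_of(_odd)`) is FALSE for this `T` (odd `l ≠ 1`);
* `epsPMInvχ_mem_cuspStabC_coverOfRecordχ'`, **`natCard_cuspOrbits_tpPiCu_coverOfRecordχ'`** — `ε_±` also stabilises the datum, and
  the `Aut_K(C̲)`-orbit space of (synthetic) cusps is ONE point (`Π^tp_C = Π^tp_{C̲} · cuspStabC`), not print's `(l+1)/2`;
* **`not_cor29_card_coverOfRecordχ'`** — so the typed `T.Cor29_card` FAILS there for odd `l ∣ p − 1`, `l ≠ 1` (where `HasMuL` holds).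
  The κ′ route (`Sec2Cor29ModelKrullOfOdd`, GEOMETRIC cusp datum) does NOT transfer; print's count at `χ′` needs a GEOMETRIC cusp
  datum (compact `D_x` with hIx — false at the Kummer-carrying χ-models, hence avoided by R312); recorded, not built.

HONEST FRAMING: a statement about OUR typed objects at a SEMI-SYNTHETIC model with a SYNTHETIC cusp datum (abc-iut-L2-t10's honest
label «the `D̄_x`-preimage of the section»); it neither refutes nor confirms [EtTh] Cor. 2.9, which concerns actual cusps of actual
orbicurves; no side is taken on [IUTchIII] Cor. 3.12; typed ≠ proved; instantiated ≠ endorsed.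
-/

noncomputable section

namespace Literature.AnabelianGeometry.EtaleTheta.SettingModel

open Literature.AnabelianGeometry.SemiGraphs ThetaCovers ThetaSetting
open _root_.Topology

variable (p : ℕ) [Fact p.Prime]

/-! ## §1. The χ-twist fixes the `Z`-generator `a` -/

/-- **`G_{ℚ_p}` fixes `a`**: `actχ σ a = a` for the degree-`1` generator `a = gfpOf (FreeGroup.of 0)` of `Γ` (the twist
`θ_u : a ↦ a, b ↦ b^u`, `twist_eta_of_zero`); a private copy of abc-iut's `actχ_gfpOf_zero` of
`Sec2Def27OrbitsOfStandardTypeModelChi` (p461839), kept local to avoid that file's imports. [cite: MochizukiEtTh2009, §1 p.12] -/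
private theorem actχ_gfpOf_zero_eq_self (σ : GQp p) : actχ p σ (gfpOf (FreeGroup.of 0)) = gfpOf (FreeGroup.of 0) := by
  apply Subtype.ext
  rw [actχ_apply, coe_twistGfp]
  exact Prod.ext (twist_eta_of_zero _) rfl

/-- `inl a` commutes with every `inr σ` in `Π^tp_X = Γ ⋊_χ G_{ℚ_p}`. [cite: MochizukiEtTh2009, §1 p.12] -/
theorem inr_mul_inl_gfpOf_zero (σ : GQp p) :
    (SemidirectProduct.inr σ : PiTpχ p) * SemidirectProduct.inl (gfpOf (FreeGroup.of 0)) =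
      SemidirectProduct.inl (gfpOf (FreeGroup.of 0)) * SemidirectProduct.inr σ := by
  have h := SemidirectProduct.inl_aut (φ := actχ p) σ (gfpOf (FreeGroup.of 0))
  rw [actχ_gfpOf_zero_eq_self, map_inv] at h
  calc (SemidirectProduct.inr σ : PiTpχ p) * SemidirectProduct.inl (gfpOf (FreeGroup.of 0))
      = SemidirectProduct.inr σ * SemidirectProduct.inl (gfpOf (FreeGroup.of 0)) * (SemidirectProduct.inr σ)⁻¹ *
          SemidirectProduct.inr σ := by group
    _ = SemidirectProduct.inl (gfpOf (FreeGroup.of 0)) * SemidirectProduct.inr σ := by rw [← h]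

/-- `a ∉ Π^tp_{X̲} = toZ⁻¹(lℤ)` for `l ≠ 1`. [cite: MochizukiEtTh2009, Def 2.5 (i) p.39] -/
theorem inl_gfpOf_zero_not_mem_GtpXu {l : ℕ+} (hl : (l : ℕ) ≠ 1) :
    (SemidirectProduct.inl (gfpOf (FreeGroup.of 0)) : PiTpχ p) ∉ (ThetaSetting.modelχ' p).GtpXu l := by
  intro h
  change (ThetaSetting.modelχ' p).toZ (SemidirectProduct.inl (gfpOf (FreeGroup.of 0))) ∈ lZ l at h
  rw [(toZ_inl_gfpOf_zero p : (ThetaSetting.modelχ' p).toZ _ = _), Subgroup.mem_zpowers_iff] at h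
  obtain ⟨k, hk⟩ := h
  rw [← ofAdd_zsmul, smul_eq_mul] at hk
  have hk' : k * (l : ℤ) = 1 := Multiplicative.ofAdd.injective hk
  have hl1 : ((l : ℕ) : ℤ) = 1 := Int.eq_one_of_mul_eq_one_left (by positivity) hk'
  exact hl (by exact_mod_cast hl1)

/-! ## §2. The R312 cover of record at `χ′`: `g_a` stabilises the synthetic cusp datum but is not in `Π^tp_{X̲}` -/

section CoverOfRecord

variable {E : (ThetaSetting.modelχ' p).EtaleThetaData} {l : ℕ+} (hodd : Odd (l : ℕ)) (C : E.DoubleUnderline (l : ℕ))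
  (eX : (ThetaSetting.modelχ' p).OncePuncturedData) (hK : (MuTwoSetting.inversionModelχ' p).barKerTp l ≤ C.Huu)
  (hsH : ∀ σ, sectionχ' p σ ∈ C.Huu) (hι : C.IotaStable ((cLevelDataInvχ' p).conjX (epsPMInvχ p)))

/-- **`g_a := inclX(inl a) ∈ T.cuspStabC`** for the R312 cover of record: `ιC(g_a)` CENTRALISES the section image `ιC(inclX(inr G_K))`
and normalises the normal `Δ̄_Θ`-preimage, hence `D_x`; pulled back along `ιC`. [cite: MochizukiEtTh2009, Def 2.1 p.35] -/
theorem inclX_inl_gfpOf_zero_mem_cuspStabC_coverOfRecordχ' :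
    (MuTwoSetting.inversionModelχ' p).inclX (SemidirectProduct.inl (gfpOf (FreeGroup.of 0))) ∈
      ((cLevelDataInvχ' p).temperedCoverDataOfHuuOfSection (cLevelDataInvχ' p).toPiCHat
        (cLevelDataInvχ' p).isProfiniteCompletion_toPiCHat (cLevelDataInvχ' p).toPiCHat_injective eX hodd (sectionχ' p)
        (aug_sectionχ' p) (toZ_sectionχ' p) (inv_ell_piCData_inversionModelχ' p l eX)
        ((cLevelDataInvχ' p).map_inclX_GtpXu_normal l (kerToZIsCompactlyGenerated_modelχ' p))
        ((cLevelDataInvχ' p).map_inclX_GtpY_normal (kerToZIsCompactlyGenerated_modelχ' p)) C hK hsH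
        (epsPMInvχ_not_mem_range p) hι).cuspStabC := by
  set M := MuTwoSetting.inversionModelχ' p with hM
  set e := cLevelDataInvχ' p with he
  set I := e.piCDataOf e.toPiCHat e.isProfiniteCompletion_toPiCHat with hI
  haveI : (I.barTheta (l : ℕ)).Normal := I.barTheta_normal (l : ℕ) eX
  -- unfold the cusp stabiliser of the assembled cover: `N(ιC⁻¹(Δ̄_Θ-preimage ⊔ sectionRange))`
  change M.inclX (SemidirectProduct.inl (gfpOf (FreeGroup.of 0))) ∈
    Subgroup.normalizer ((((I.barTheta (l : ℕ) ⊔ I.sectionRange (sectionχ' p)).comap e.toPiCHat.toMonoidHom :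
      Subgroup M.GtpC)) : Set M.GtpC)
  refine Subgroup.le_normalizer_comap e.toPiCHat.toMonoidHom ?_
  rw [Subgroup.mem_comap, sup_comm]
  refine normalizer_le_normalizer_sup (I.sectionRange (sectionχ' p)) (I.barTheta (l : ℕ)) ?_
  refine Subgroup.centralizer_le_normalizer _ ?_
  rw [Subgroup.mem_centralizer_iff]
  rintro h ⟨σ, rfl⟩
  change I.incl (M.toHat (sectionχ' p σ)) * e.toPiCHat (M.inclX (SemidirectProduct.inl (gfpOf (FreeGroup.of 0)))) =
    e.toPiCHat (M.inclX (SemidirectProduct.inl (gfpOf (FreeGroup.of 0)))) * I.incl (M.toHat (sectionχ' p σ))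
  rw [hI, e.piCDataOf_incl_toHat, ← map_mul, ← map_mul, ← map_mul, ← map_mul]
  exact congrArg _ (congrArg _ (inr_mul_inl_gfpOf_zero p (σ : GQp p)))

/-- `g_a ∈ T.tp T.PiX` (`= inclX(Π^tp_X)`). [cite: MochizukiEtTh2009, Prop 2.4 p.38] -/
theorem inclX_inl_gfpOf_zero_mem_tp_PiX_coverOfRecordχ' :
    (MuTwoSetting.inversionModelχ' p).inclX (SemidirectProduct.inl (gfpOf (FreeGroup.of 0))) ∈
      ((cLevelDataInvχ' p).temperedCoverDataOfHuuOfSection (cLevelDataInvχ' p).toPiCHat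
        (cLevelDataInvχ' p).isProfiniteCompletion_toPiCHat (cLevelDataInvχ' p).toPiCHat_injective eX hodd (sectionχ' p)
        (aug_sectionχ' p) (toZ_sectionχ' p) (inv_ell_piCData_inversionModelχ' p l eX)
        ((cLevelDataInvχ' p).map_inclX_GtpXu_normal l (kerToZIsCompactlyGenerated_modelχ' p))
        ((cLevelDataInvχ' p).map_inclX_GtpY_normal (kerToZIsCompactlyGenerated_modelχ' p)) C hK hsH
        (epsPMInvχ_not_mem_range p) hι).tp
      ((cLevelDataInvχ' p).temperedCoverDataOfHuuOfSection (cLevelDataInvχ' p).toPiCHat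
        (cLevelDataInvχ' p).isProfiniteCompletion_toPiCHat (cLevelDataInvχ' p).toPiCHat_injective eX hodd (sectionχ' p)
        (aug_sectionχ' p) (toZ_sectionχ' p) (inv_ell_piCData_inversionModelχ' p l eX)
        ((cLevelDataInvχ' p).map_inclX_GtpXu_normal l (kerToZIsCompactlyGenerated_modelχ' p))
        ((cLevelDataInvχ' p).map_inclX_GtpY_normal (kerToZIsCompactlyGenerated_modelχ' p)) C hK hsH
        (epsPMInvχ_not_mem_range p) hι).PiX := by
  set M := MuTwoSetting.inversionModelχ' p with hM
  set e := cLevelDataInvχ' p with he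
  change M.inclX (SemidirectProduct.inl (gfpOf (FreeGroup.of 0))) ∈
    ((e.piCDataOf e.toPiCHat e.isProfiniteCompletion_toPiCHat).incl.toMonoidHom.range).comap e.toPiCHat.toMonoidHom
  rw [MuTwoSetting.CLevelData.comap_range_hatInclX e.toPiCHat e.isProfiniteCompletion_toPiCHat _
    (e.piCDataOf_incl_toHat e.toPiCHat e.isProfiniteCompletion_toPiCHat)]
  exact ⟨_, rfl⟩

/-- **`g_a ∉ T.tp T.PiXu`** (`= inclX(Π^tp_{X̲})`, abc-iut-L2-d3's `temperedCoverDataOfHuuOfSection_tp_PiXu`), for `l ≠ 1`.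
[cite: MochizukiEtTh2009, Def 2.5 (i) p.39] -/
theorem inclX_inl_gfpOf_zero_not_mem_tp_PiXu_coverOfRecordχ' (hl : (l : ℕ) ≠ 1) :
    (MuTwoSetting.inversionModelχ' p).inclX (SemidirectProduct.inl (gfpOf (FreeGroup.of 0))) ∉
      ((cLevelDataInvχ' p).temperedCoverDataOfHuuOfSection (cLevelDataInvχ' p).toPiCHat
        (cLevelDataInvχ' p).isProfiniteCompletion_toPiCHat (cLevelDataInvχ' p).toPiCHat_injective eX hodd (sectionχ' p)
        (aug_sectionχ' p) (toZ_sectionχ' p) (inv_ell_piCData_inversionModelχ' p l eX)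
        ((cLevelDataInvχ' p).map_inclX_GtpXu_normal l (kerToZIsCompactlyGenerated_modelχ' p))
        ((cLevelDataInvχ' p).map_inclX_GtpY_normal (kerToZIsCompactlyGenerated_modelχ' p)) C hK hsH
        (epsPMInvχ_not_mem_range p) hι).tp
      ((cLevelDataInvχ' p).temperedCoverDataOfHuuOfSection (cLevelDataInvχ' p).toPiCHat
        (cLevelDataInvχ' p).isProfiniteCompletion_toPiCHat (cLevelDataInvχ' p).toPiCHat_injective eX hodd (sectionχ' p)
        (aug_sectionχ' p) (toZ_sectionχ' p) (inv_ell_piCData_inversionModelχ' p l eX)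
        ((cLevelDataInvχ' p).map_inclX_GtpXu_normal l (kerToZIsCompactlyGenerated_modelχ' p))
        ((cLevelDataInvχ' p).map_inclX_GtpY_normal (kerToZIsCompactlyGenerated_modelχ' p)) C hK hsH
        (epsPMInvχ_not_mem_range p) hι).PiXu := by
  rw [(cLevelDataInvχ' p).temperedCoverDataOfHuuOfSection_tp_PiXu _ _ _ eX hodd _ _ _ _ _ _ C hK hsH _ hι]
  intro h
  exact inl_gfpOf_zero_not_mem_GtpXu p hl
    ((Subgroup.mem_map_iff_mem (MuTwoSetting.inversionModelχ' p).injective_inclX).mp h)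

/-- **FINDING F-L2t12g9-1 — `hC1` FAILS for the R312 cover of record at `χ′`** (odd `l ≠ 1`): the stabiliser of its SYNTHETIC cusp
datum meets `Π^tp_X` outside `Π^tp_{X̲}` (witness `g_a`), so the Cor. 2.9 engine does not fire there. [cite: MochizukiEtTh2009, Cor 2.9 p.43] -/
theorem not_hC1_coverOfRecordχ' (hl : (l : ℕ) ≠ 1) :
    ¬ (((cLevelDataInvχ' p).temperedCoverDataOfHuuOfSection (cLevelDataInvχ' p).toPiCHat
        (cLevelDataInvχ' p).isProfiniteCompletion_toPiCHat (cLevelDataInvχ' p).toPiCHat_injective eX hodd (sectionχ' p)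
        (aug_sectionχ' p) (toZ_sectionχ' p) (inv_ell_piCData_inversionModelχ' p l eX)
        ((cLevelDataInvχ' p).map_inclX_GtpXu_normal l (kerToZIsCompactlyGenerated_modelχ' p))
        ((cLevelDataInvχ' p).map_inclX_GtpY_normal (kerToZIsCompactlyGenerated_modelχ' p)) C hK hsH
        (epsPMInvχ_not_mem_range p) hι).cuspStabC ⊓
      ((cLevelDataInvχ' p).temperedCoverDataOfHuuOfSection (cLevelDataInvχ' p).toPiCHat
        (cLevelDataInvχ' p).isProfiniteCompletion_toPiCHat (cLevelDataInvχ' p).toPiCHat_injective eX hodd (sectionχ' p)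
        (aug_sectionχ' p) (toZ_sectionχ' p) (inv_ell_piCData_inversionModelχ' p l eX)
        ((cLevelDataInvχ' p).map_inclX_GtpXu_normal l (kerToZIsCompactlyGenerated_modelχ' p))
        ((cLevelDataInvχ' p).map_inclX_GtpY_normal (kerToZIsCompactlyGenerated_modelχ' p)) C hK hsH
        (epsPMInvχ_not_mem_range p) hι).tp
      ((cLevelDataInvχ' p).temperedCoverDataOfHuuOfSection (cLevelDataInvχ' p).toPiCHat
        (cLevelDataInvχ' p).isProfiniteCompletion_toPiCHat (cLevelDataInvχ' p).toPiCHat_injective eX hodd (sectionχ' p)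
        (aug_sectionχ' p) (toZ_sectionχ' p) (inv_ell_piCData_inversionModelχ' p l eX)
        ((cLevelDataInvχ' p).map_inclX_GtpXu_normal l (kerToZIsCompactlyGenerated_modelχ' p))
        ((cLevelDataInvχ' p).map_inclX_GtpY_normal (kerToZIsCompactlyGenerated_modelχ' p)) C hK hsH
        (epsPMInvχ_not_mem_range p) hι).PiX ≤
      ((cLevelDataInvχ' p).temperedCoverDataOfHuuOfSection (cLevelDataInvχ' p).toPiCHat
        (cLevelDataInvχ' p).isProfiniteCompletion_toPiCHat (cLevelDataInvχ' p).toPiCHat_injective eX hodd (sectionχ' p)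
        (aug_sectionχ' p) (toZ_sectionχ' p) (inv_ell_piCData_inversionModelχ' p l eX)
        ((cLevelDataInvχ' p).map_inclX_GtpXu_normal l (kerToZIsCompactlyGenerated_modelχ' p))
        ((cLevelDataInvχ' p).map_inclX_GtpY_normal (kerToZIsCompactlyGenerated_modelχ' p)) C hK hsH
        (epsPMInvχ_not_mem_range p) hι).tp
      ((cLevelDataInvχ' p).temperedCoverDataOfHuuOfSection (cLevelDataInvχ' p).toPiCHat
        (cLevelDataInvχ' p).isProfiniteCompletion_toPiCHat (cLevelDataInvχ' p).toPiCHat_injective eX hodd (sectionχ' p)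
        (aug_sectionχ' p) (toZ_sectionχ' p) (inv_ell_piCData_inversionModelχ' p l eX)
        ((cLevelDataInvχ' p).map_inclX_GtpXu_normal l (kerToZIsCompactlyGenerated_modelχ' p))
        ((cLevelDataInvχ' p).map_inclX_GtpY_normal (kerToZIsCompactlyGenerated_modelχ' p)) C hK hsH
        (epsPMInvχ_not_mem_range p) hι).PiXu) := fun h =>
  inclX_inl_gfpOf_zero_not_mem_tp_PiXu_coverOfRecordχ' p hodd C eX hK hsH hι hl
    (h ⟨inclX_inl_gfpOf_zero_mem_cuspStabC_coverOfRecordχ' p hodd C eX hK hsH hι,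
      inclX_inl_gfpOf_zero_mem_tp_PiX_coverOfRecordχ' p hodd C eX hK hsH hι⟩)


/-! ## §3. `ε_±` also stabilises the synthetic cusp datum; the cusp-orbit space of `C̲` COLLAPSES to a point -/

/-- `T.tp T.Dx`-membership of the section image: `inclX(inr σ) ∈ Π^tp`-pull-back of `D_x = Δ̄_Θ-preimage ⊔ incl(ŝ(G_K))`
(`G_K = G_{ℚ_p}` at `χ′`). [cite: MochizukiEtTh2009, Def 2.1 p.35] -/
theorem inclX_inr_mem_tp_Dx_coverOfRecordχ' (σ : GQp p) :
    (MuTwoSetting.inversionModelχ' p).inclX (SemidirectProduct.inr σ) ∈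
      ((cLevelDataInvχ' p).temperedCoverDataOfHuuOfSection (cLevelDataInvχ' p).toPiCHat
        (cLevelDataInvχ' p).isProfiniteCompletion_toPiCHat (cLevelDataInvχ' p).toPiCHat_injective eX hodd (sectionχ' p)
        (aug_sectionχ' p) (toZ_sectionχ' p) (inv_ell_piCData_inversionModelχ' p l eX)
        ((cLevelDataInvχ' p).map_inclX_GtpXu_normal l (kerToZIsCompactlyGenerated_modelχ' p))
        ((cLevelDataInvχ' p).map_inclX_GtpY_normal (kerToZIsCompactlyGenerated_modelχ' p)) C hK hsH
        (epsPMInvχ_not_mem_range p) hι).tp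
      ((cLevelDataInvχ' p).temperedCoverDataOfHuuOfSection (cLevelDataInvχ' p).toPiCHat
        (cLevelDataInvχ' p).isProfiniteCompletion_toPiCHat (cLevelDataInvχ' p).toPiCHat_injective eX hodd (sectionχ' p)
        (aug_sectionχ' p) (toZ_sectionχ' p) (inv_ell_piCData_inversionModelχ' p l eX)
        ((cLevelDataInvχ' p).map_inclX_GtpXu_normal l (kerToZIsCompactlyGenerated_modelχ' p))
        ((cLevelDataInvχ' p).map_inclX_GtpY_normal (kerToZIsCompactlyGenerated_modelχ' p)) C hK hsH
        (epsPMInvχ_not_mem_range p) hι).Dx := by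
  set M := MuTwoSetting.inversionModelχ' p with hM
  set e := cLevelDataInvχ' p with he
  set I := e.piCDataOf e.toPiCHat e.isProfiniteCompletion_toPiCHat with hI
  change M.inclX (SemidirectProduct.inr σ) ∈
    ((I.barTheta (l : ℕ) ⊔ I.sectionRange (sectionχ' p)).comap e.toPiCHat.toMonoidHom : Subgroup M.GtpC)
  rw [Subgroup.mem_comap]
  refine Subgroup.mem_sup_right ⟨⟨σ, by rw [GK_modelχ']; exact Subgroup.mem_top σ⟩, ?_⟩
  change I.incl (M.toHat (sectionχ' p _)) = e.toPiCHat (M.inclX (SemidirectProduct.inr σ))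
  rw [hI, e.piCDataOf_incl_toHat]
  rfl

/-- **`ε_±` lies in the cusp stabiliser too**: conjugation by `ε_±` is the twisted inversion on `Π^tp_X`
(`epsPM_conj_inlχ`), which FIXES `inr σ` (`twistedInversion_inr`); `Δ̄_Θ`-preimage is normal. [cite: MochizukiEtTh2009, Def 2.1 p.35] -/
theorem epsPMInvχ_mem_cuspStabC_coverOfRecordχ' :
    epsPMInvχ p ∈
      ((cLevelDataInvχ' p).temperedCoverDataOfHuuOfSection (cLevelDataInvχ' p).toPiCHat
        (cLevelDataInvχ' p).isProfiniteCompletion_toPiCHat (cLevelDataInvχ' p).toPiCHat_injective eX hodd (sectionχ' p)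
        (aug_sectionχ' p) (toZ_sectionχ' p) (inv_ell_piCData_inversionModelχ' p l eX)
        ((cLevelDataInvχ' p).map_inclX_GtpXu_normal l (kerToZIsCompactlyGenerated_modelχ' p))
        ((cLevelDataInvχ' p).map_inclX_GtpY_normal (kerToZIsCompactlyGenerated_modelχ' p)) C hK hsH
        (epsPMInvχ_not_mem_range p) hι).cuspStabC := by
  set M := MuTwoSetting.inversionModelχ' p with hM
  set e := cLevelDataInvχ' p with he
  set I := e.piCDataOf e.toPiCHat e.isProfiniteCompletion_toPiCHat with hI
  haveI : (I.barTheta (l : ℕ)).Normal := I.barTheta_normal (l : ℕ) eX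
  change epsPMInvχ p ∈
    Subgroup.normalizer ((((I.barTheta (l : ℕ) ⊔ I.sectionRange (sectionχ' p)).comap e.toPiCHat.toMonoidHom :
      Subgroup M.GtpC)) : Set M.GtpC)
  refine Subgroup.le_normalizer_comap e.toPiCHat.toMonoidHom ?_
  rw [Subgroup.mem_comap, sup_comm]
  refine normalizer_le_normalizer_sup (I.sectionRange (sectionχ' p)) (I.barTheta (l : ℕ)) ?_
  refine Subgroup.centralizer_le_normalizer _ ?_
  rw [Subgroup.mem_centralizer_iff]
  rintro h ⟨σ, rfl⟩
  change I.incl (M.toHat (sectionχ' p σ)) * e.toPiCHat (epsPMInvχ p) = e.toPiCHat (epsPMInvχ p) * I.incl (M.toHat (sectionχ' p σ))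
  rw [hI, e.piCDataOf_incl_toHat]
  -- `ε_± · inclX(inr σ) · ε_±⁻¹ = inclX(ι(inr σ)) = inclX(inr σ)`
  have hconj : epsPMInvχ p * M.inclX (sectionχ' p σ) * (epsPMInvχ p)⁻¹ = M.inclX (sectionχ' p σ) := by
    change epsPMInvχ p * inclInvχ p (SemidirectProduct.inr (σ : GQp p)) * (epsPMInvχ p)⁻¹ =
      inclInvχ p (SemidirectProduct.inr (σ : GQp p))
    rw [epsPM_conj_inlχ, twistedInversion_inr]
  have h2 : e.toPiCHat (epsPMInvχ p) * e.toPiCHat (M.inclX (sectionχ' p σ)) * (e.toPiCHat (epsPMInvχ p))⁻¹ =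
      e.toPiCHat (M.inclX (sectionχ' p σ)) := by
    rw [← map_mul, ← map_inv, ← map_mul, hconj]
  calc e.toPiCHat (M.inclX (sectionχ' p σ)) * e.toPiCHat (epsPMInvχ p)
      = e.toPiCHat (epsPMInvχ p) * e.toPiCHat (M.inclX (sectionχ' p σ)) * (e.toPiCHat (epsPMInvχ p))⁻¹ *
          e.toPiCHat (epsPMInvχ p) := by rw [h2]
    _ = e.toPiCHat (epsPMInvχ p) * e.toPiCHat (M.inclX (sectionχ' p σ)) := by group

/-- **The `Aut_K(C̲)`-orbit space of cusps of the R312 cover of record at `χ′` is ONE POINT** (for the SYNTHETIC cusp datum):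
`Π^tp_C = Π^tp_{C̲} · cuspStabC`, since `cuspStabC ∋ inclX(inl a)` (the `Z`-direction), `∋ inclX(inr σ)` and `∋ ε_±`, while every
`inclX(inl γ)` with `toZ γ = 0` lies in `Π^tp_{X̲} ≤ Π^tp_{C̲}`. Print's count would be `(l+1)/2`. [cite: MochizukiEtTh2009, Cor 2.9 p.43] -/
theorem natCard_cuspOrbits_tpPiCu_coverOfRecordχ' :
    Nat.card (((cLevelDataInvχ' p).temperedCoverDataOfHuuOfSection (cLevelDataInvχ' p).toPiCHat
        (cLevelDataInvχ' p).isProfiniteCompletion_toPiCHat (cLevelDataInvχ' p).toPiCHat_injective eX hodd (sectionχ' p)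
        (aug_sectionχ' p) (toZ_sectionχ' p) (inv_ell_piCData_inversionModelχ' p l eX)
        ((cLevelDataInvχ' p).map_inclX_GtpXu_normal l (kerToZIsCompactlyGenerated_modelχ' p))
        ((cLevelDataInvχ' p).map_inclX_GtpY_normal (kerToZIsCompactlyGenerated_modelχ' p)) C hK hsH
        (epsPMInvχ_not_mem_range p) hι).cuspOrbits
      (((cLevelDataInvχ' p).temperedCoverDataOfHuuOfSection (cLevelDataInvχ' p).toPiCHat
        (cLevelDataInvχ' p).isProfiniteCompletion_toPiCHat (cLevelDataInvχ' p).toPiCHat_injective eX hodd (sectionχ' p)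
        (aug_sectionχ' p) (toZ_sectionχ' p) (inv_ell_piCData_inversionModelχ' p l eX)
        ((cLevelDataInvχ' p).map_inclX_GtpXu_normal l (kerToZIsCompactlyGenerated_modelχ' p))
        ((cLevelDataInvχ' p).map_inclX_GtpY_normal (kerToZIsCompactlyGenerated_modelχ' p)) C hK hsH
        (epsPMInvχ_not_mem_range p) hι).tp
      ((cLevelDataInvχ' p).temperedCoverDataOfHuuOfSection (cLevelDataInvχ' p).toPiCHat
        (cLevelDataInvχ' p).isProfiniteCompletion_toPiCHat (cLevelDataInvχ' p).toPiCHat_injective eX hodd (sectionχ' p)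
        (aug_sectionχ' p) (toZ_sectionχ' p) (inv_ell_piCData_inversionModelχ' p l eX)
        ((cLevelDataInvχ' p).map_inclX_GtpXu_normal l (kerToZIsCompactlyGenerated_modelχ' p))
        ((cLevelDataInvχ' p).map_inclX_GtpY_normal (kerToZIsCompactlyGenerated_modelχ' p)) C hK hsH
        (epsPMInvχ_not_mem_range p) hι).PiCu)) = 1 := by
  set M := MuTwoSetting.inversionModelχ' p with hM
  set T := (cLevelDataInvχ' p).temperedCoverDataOfHuuOfSection (cLevelDataInvχ' p).toPiCHat
        (cLevelDataInvχ' p).isProfiniteCompletion_toPiCHat (cLevelDataInvχ' p).toPiCHat_injective eX hodd (sectionχ' p)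
        (aug_sectionχ' p) (toZ_sectionχ' p) (inv_ell_piCData_inversionModelχ' p l eX)
        ((cLevelDataInvχ' p).map_inclX_GtpXu_normal l (kerToZIsCompactlyGenerated_modelχ' p))
        ((cLevelDataInvχ' p).map_inclX_GtpY_normal (kerToZIsCompactlyGenerated_modelχ' p)) C hK hsH
        (epsPMInvχ_not_mem_range p) hι with hT
  -- the two subgroups of the double coset space
  have hXuCu : T.tp T.PiXu ≤ T.tp T.PiCu :=
    Subgroup.comap_mono (sup_le_sup_right (inf_le_left : T.PiXuu ≤ T.PiCuu) T.barTheta)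
  have hXuN : T.tp T.PiXu ≤ Subgroup.normalizer ((T.tp T.PiCu : Subgroup T.Gtp) : Set T.Gtp) :=
    hXuCu.trans Subgroup.le_normalizer
  set N : Subgroup T.Gtp := Subgroup.normalizer ((T.tp T.PiCu : Subgroup T.Gtp) : Set T.Gtp) with hN
  set K : Subgroup T.Gtp := T.cuspStabC with hK'
  have ha : M.inclX (SemidirectProduct.inl (gfpOf (FreeGroup.of 0))) ∈ K :=
    inclX_inl_gfpOf_zero_mem_cuspStabC_coverOfRecordχ' p hodd C eX hK hsH hι
  have hε : epsPMInvχ p ∈ K := epsPMInvχ_mem_cuspStabC_coverOfRecordχ' p hodd C eX hK hsH hι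
  have hσ : ∀ σ : GQp p, M.inclX (SemidirectProduct.inr σ) ∈ K := fun σ =>
    Subgroup.le_normalizer (inclX_inr_mem_tp_Dx_coverOfRecordχ' p hodd C eX hK hsH hι σ)
  have ht : ∀ t : Multiplicative (ZMod 2), (SemidirectProduct.inr t : PiCInvχ p) ∈ K := by
    intro t
    rcases (by decide : ∀ t : Multiplicative (ZMod 2), t = 1 ∨ t = Multiplicative.ofAdd 1) t with rfl | rfl
    · rw [map_one]; exact K.one_mem
    · exact hε
  -- every double coset is the coset of `1`
  have hXu : T.tp T.PiXu = ((ThetaSetting.modelχ' p).GtpXu l).map M.inclX :=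
    (cLevelDataInvχ' p).temperedCoverDataOfHuuOfSection_tp_PiXu _ _ _ eX hodd _ _ _ _ _ _ C hK hsH _ hι
  have hsnd_a : gfpSnd (gfpOf (FreeGroup.of 0)) = Multiplicative.ofAdd 1 := by
    rw [gfpSnd_gfpOf, ← zpow_one (FreeGroup.of (0 : Fin 2)), expA_of_zero_zpow]
  -- every double coset is the coset of `1`
  have key : ∀ x : PiCInvχ p, DoubleCoset.mk N K (1 : PiCInvχ p) = DoubleCoset.mk N K x := by
    intro x
    rw [DoubleCoset.eq]
    -- decompose `x = inclX(inl γ · inr σ) · inr t`, `γ = γ₀ · a^d` with `toZ γ₀ = 0`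
    set γ : Gfp := x.left.left with hγ
    set σ : GQp p := x.left.right with hσ'
    set t : Multiplicative (ZMod 2) := x.right with ht'
    set a : Gfp := gfpOf (FreeGroup.of 0) with ha'
    set d : ℤ := Multiplicative.toAdd (gfpSnd γ) with hd
    set γ₀ : Gfp := γ * (a ^ d)⁻¹ with hγ₀
    have hγeq : γ = γ₀ * a ^ d := by rw [hγ₀, inv_mul_cancel_right]
    have hx : x = (SemidirectProduct.inl (SemidirectProduct.inl γ₀ : PiTpχ p) : PiCInvχ p) *
        ((SemidirectProduct.inl (SemidirectProduct.inl a : PiTpχ p) : PiCInvχ p) ^ d *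
          (SemidirectProduct.inl (SemidirectProduct.inr σ : PiTpχ p) : PiCInvχ p) *
          (SemidirectProduct.inr t : PiCInvχ p)) := by
      calc x = SemidirectProduct.inl x.left * SemidirectProduct.inr x.right :=
            (SemidirectProduct.inl_left_mul_inr_right x).symm
        _ = SemidirectProduct.inl ((SemidirectProduct.inl γ : PiTpχ p) * SemidirectProduct.inr σ) *
              SemidirectProduct.inr t := by
            rw [SemidirectProduct.inl_left_mul_inr_right x.left]
        _ = _ := by
            rw [hγeq]
            simp only [map_mul, map_zpow, mul_assoc]
    -- `toZ γ₀ = 0`, so `inclX(inl γ₀) ∈ Π^tp_{X̲} ≤ N`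
    have hsnd : gfpSnd γ₀ = 1 := by
      rw [hγ₀, map_mul, map_inv, map_zpow, hsnd_a, ← ofAdd_zsmul, smul_eq_mul, mul_one]
      have : gfpSnd γ = Multiplicative.ofAdd d := by rw [hd, ofAdd_toAdd]
      rw [this, mul_inv_cancel]
    have hγ₀X : M.inclX (SemidirectProduct.inl γ₀) ∈ T.tp T.PiXu := by
      refine hXu ▸ ⟨SemidirectProduct.inl γ₀, ?_, rfl⟩
      change (ThetaSetting.modelχ' p).toZ (SemidirectProduct.inl γ₀) ∈ lZ l
      have : (ThetaSetting.modelχ' p).toZ (SemidirectProduct.inl γ₀) = gfpSnd γ₀ := by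
        change gfpSnd (SemidirectProduct.inl γ₀ : PiTpχ p).left = _
        rw [SemidirectProduct.left_inl]
      rw [this, hsnd]
      exact (lZ l).one_mem
    refine ⟨M.inclX (SemidirectProduct.inl γ₀), hXuN hγ₀X,
      (M.inclX (SemidirectProduct.inl a)) ^ d * M.inclX (SemidirectProduct.inr σ) * SemidirectProduct.inr t,
      K.mul_mem (K.mul_mem (K.zpow_mem ha d) (hσ σ)) (ht t), ?_⟩
    exact hx.trans (congrArg (· * _) (mul_one _).symm)
  rw [Nat.card_eq_one_iff_unique]
  refine ⟨⟨fun u v => ?_⟩, ⟨DoubleCoset.mk N K 1⟩⟩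
  induction u using Quotient.inductionOn' with
  | h u =>
    induction v using Quotient.inductionOn' with
    | h v =>
      change DoubleCoset.mk N K u = DoubleCoset.mk N K v
      rw [← key u, ← key v]

/-- **FINDING F-L2t12g9-1, the NEGATIVE in the kernel: the typed Cor. 2.9 (`T.Cor29_card`) FAILS for the R312 cover of record at
`χ′` whenever its antecedent `HasMuL` holds** — i.e. for odd `l ∣ p − 1`, `l ≠ 1` (`hasMuL_coverOfRecordχ'`): the member `C̲` has ONE
`Aut_K`-orbit of (synthetic) cusps, not print's `(l+1)/2 ≥ 2`. READING: the SYNTHETIC section cusp datum of the R312 constructor cannot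
carry Cor. 2.9's count; a GEOMETRIC cusp datum at `χ′` is what print's statement needs (not in the tree: hIx fails at the χ-models).
SEMI-SYNTHETIC model; a statement about OUR typed objects only. [cite: MochizukiEtTh2009, Cor 2.9 p.43] -/
theorem not_cor29_card_coverOfRecordχ' (hl1 : (l : ℕ) ≠ 1) (hl : (l : ℕ) ∣ p - 1) :
    ¬ ((cLevelDataInvχ' p).temperedCoverDataOfHuuOfSection (cLevelDataInvχ' p).toPiCHat
        (cLevelDataInvχ' p).isProfiniteCompletion_toPiCHat (cLevelDataInvχ' p).toPiCHat_injective eX hodd (sectionχ' p)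
        (aug_sectionχ' p) (toZ_sectionχ' p) (inv_ell_piCData_inversionModelχ' p l eX)
        ((cLevelDataInvχ' p).map_inclX_GtpXu_normal l (kerToZIsCompactlyGenerated_modelχ' p))
        ((cLevelDataInvχ' p).map_inclX_GtpY_normal (kerToZIsCompactlyGenerated_modelχ' p)) C hK hsH
        (epsPMInvχ_not_mem_range p) hι).Cor29_card := by
  intro h29
  have hcount := h29 (hasMuL_coverOfRecordχ' p hodd hl C eX hK hsH hι) _
    (List.mem_cons_of_mem _ (List.mem_cons_of_mem _ (List.mem_cons_of_mem _
      (List.mem_cons_of_mem _ List.mem_cons_self))))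
  rw [natCard_cuspOrbits_tpPiCu_coverOfRecordχ' p hodd C eX hK hsH hι] at hcount
  -- `1 = (l + 1) / 2` forces `l ≤ 1`, contradicting `l` odd, `l ≠ 1`
  obtain ⟨m, hm⟩ := hodd
  have hl0 : (l : ℕ) ≠ 0 := l.ne_zero
  omega

end CoverOfRecord

end Literature.AnabelianGeometry.EtaleTheta.SettingModel

end
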